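import Summits.QuantumFields.YangMills.Theorems.BalabanUVNodesN13GaugeFixingSequentialLayer

/-!
# BalabanUVNodes ∕ N13 — GAUGING AWAY ALL NON-WRAPPING DIRECTION-0 BONDS (layered Faddeev–Popov): the SHARP Gaussian lower bound on Bałaban's fine-lattice Wilson `Z`,
# coefficient `((d−1) + 1∕n)(N²−1)∕2` of `|T₁^{(0)}|·log β` (print's transversal count `(d−1)` up to the one wrap bond per line)

(Track A, DAG node N13 = [B16]; cluster K1 — K1⁹ `StabilityBRunRowsAtRecordR13SepCoPHV` = stmt-QuantumFields-27364, helper; seat `pub-ymgap-dag-n13-w3` g5; 2026-08-28; count-neutral.)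
Sharpening of this seat's F19∕F20 (p634656 ∕ p635238): the even-`x₀` MATCHING gauged away `|T|∕2` bonds at once (coefficient `(d−½)(N²−1)∕2`); here the whole family
`{⟨x, e₀⟩ : x₀ ≠ n−1}` of direction-`0` bonds that do not wrap around the torus (`n = 2L^{m+K−j}` sites per direction) is gauged away LAYER BY LAYER (`x₀ = 0, 1, …, n−2`) with the
sequential step of `…N13GaugeFixingSequentialLayer`: each layer is target-disjoint and its targets (`x₀ = t+1`) avoid every endpoint of the layers below.  Result (§1):
`haar(B)^{|T|(1−1∕n)}·∫F = ∫ F·Π_{x₀≠n−1} 1_B(U⟨x,e₀⟩) dU`, whence (§2) for `G = SU(N)`, `β ≥ 1`: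
`log Z_P(β) ≥ −((d−1) + 1∕n)·|T₁^{(0)}|·((N²−1)∕2·log β + C_N) − 8d²·|T₁^{(0)}|` — the `log β` coefficient `(3∕2 + 1∕(2n))(N²−1)` at `d = 4` is print's Gaussian count `(3∕2)d(𝔤)`
([Balaban1988Convergent] (1.15): `d(𝔤)` per integrated TRANSVERSAL bond) up to `1∕(2n) → 0` along the continuum runs.  Consumed by `…N13NormalisationSlopeThresholdAtRecord13SepCoPHV`:
the no-go of p636072 extends from coupling-blind inputs to every normalisation whose coupling SLOPE is below print's `d(𝔤)∕4` (up to `O(L⁻⁴)`).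

WHAT IS PROVED ([folklore] measure theory + counting; 0 `sorry`, 0 `def`): §1 `val_shift_dir`, `shift_apply_ne`, ★ `pow_mul_integral_eq_prod_indicator_below` (induction on the height),
`card_below_top` (`n·|{x₀ ≠ n−1 bonds}| = (n−1)·|T|`: the fibres of `x ↦ x₀` are equicardinal); §2 ★★★ `log_partitionFn_ge_axialLayers_specialUnitary` and its `d = 4` form.
HONEST FRAMING: elementary; nothing of Bałaban's asserted or refuted; no skeleton ∕ route text touched; N13 NOT discharged; K1⁹ NEITHER proved NOR refuted; counts UNMOVED (typed 28∕28 ·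
discharged 5∕27 · A 5∕28); R4 closes the conditional finite-𝕋⁴ rung `BalabanLadder.UV` only — the Yang–Mills mass gap (Clay) is NOT proved by any of this; nothing continuum ∕ ℝ⁴ ∕ OS.
No `sorry`, `def`, `instance`, `notation`.
-/

noncomputable section

open MeasureTheory
open scoped BigOperators

namespace Summit.QuantumFields.YangMills.BalabanUVNodes.N13GaugeFixingAxialLayers

open Literature.MathematicalPhysics.QuantumFieldTheory.Balaban1983to89
open Missing
open Summit.QuantumFields.YangMills.BalabanUVNodes.N13GaugeFixingTargetDisjointBondFamily (integral_indicator_mul_left_eq_haarReal gaugeInvariant_boltzmann)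
open Summit.QuantumFields.YangMills.BalabanUVNodes.N13WilsonPartitionFnGaugeFixedLowerBound (card_plaq_le log_haarReal_suOpBall_ge wilsonAction4_le_of_bondBall)
open Summit.QuantumFields.YangMills.BalabanUVNodes.N13GaugeFixingSequentialLayer (pow_mul_integral_eq_of_layer)

/-! ## §1. The direction-0 layers graded by the height `x₀ ∈ {0, …, n−1}` -/

section Layers

variable (P : Params) (j : ℕ)

/-- The height of the target: `((x + e₀) 0).val = (x 0).val + 1` as long as `x₀ + 1 < n` (no wrap). [folklore] -/
theorem val_shift_dir (x : Site P j) (i0 : Fin P.d) (hx : (x i0).val + 1 < P.sitesPerDir j) :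
    ((x.shift i0) i0).val = (x i0).val + 1 := by
  have h1 : (x.shift i0) i0 = x i0 + 1 := by simp [Site.shift]
  rw [h1]
  have h2 : (x i0 + 1 : ZMod (P.sitesPerDir j)) = (((x i0).val + 1 : ℕ) : ZMod (P.sitesPerDir j)) := by
    push_cast; rw [ZMod.natCast_zmod_val]
  rw [h2, ZMod.val_natCast, Nat.mod_eq_of_lt hx]

/-- Off the direction `i0` a shift does not move the coordinates. [folklore] -/
theorem shift_apply_ne (x : Site P j) (i0 κ : Fin P.d) (hκ : κ ≠ i0) : (x.shift i0) κ = x κ := by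
  simp [Site.shift, hκ]

/-- **THE LAYERED GAUGE: `haar(B)^{|below t|}·∫F = ∫F·Π_{below t}1_B`** for every gauge-invariant bounded measurable `F`, every measurable `B`, and every height `t ≤ n−1`, where `below t` is the
family of direction-`0` bonds `⟨x, e₀⟩` with `(x 0).val < t` (induction on `t`: the layer `(x 0).val = t` is target-disjoint, `tgt`-injective, disjoint from `below t`, and its targets — height
`t+1` — are endpoints of no bond below). [cite: Balaban1987RG1, (0.15)–(0.16) pp.254–255 (bookkeeping)] -/
theorem pow_mul_integral_eq_prod_indicator_below {G : Type*} [GaugeGroup G] [MeasurableSpace G] [HaarData G] [MeasurableMul₂ G]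
    {B : Set G} (hB : MeasurableSet B) {F : GaugeField P j G → ℝ} (hF : GaugeField.GaugeInvariant F)
    (hFi : Integrable F (fieldMeasure P j G)) (t : ℕ) (ht : t + 1 ≤ P.sitesPerDir j) :
    (HaarData.haar : Measure G).real B ^ (Finset.univ.filter fun b : PBond P j => b.dir = ⟨0, P.hd⟩ ∧ (b.src ⟨0, P.hd⟩).val < t).card *
        ∫ U, F U ∂(fieldMeasure P j G) =
      ∫ U, F U * ∏ b ∈ (Finset.univ.filter fun b : PBond P j => b.dir = ⟨0, P.hd⟩ ∧ (b.src ⟨0, P.hd⟩).val < t),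
        B.indicator (fun _ => (1 : ℝ)) (U b) ∂(fieldMeasure P j G) := by
  classical
  set i0 : Fin P.d := ⟨0, P.hd⟩ with hi0
  induction t with
  | zero =>
    have h0 : (Finset.univ.filter fun b : PBond P j => b.dir = i0 ∧ (b.src i0).val < 0) = ∅ := by
      ext b; simp
    rw [h0]
    simp
  | succ t ih =>
    have ht' : t + 1 ≤ P.sitesPerDir j := by omega
    have hIH := ih ht'
    set S : Finset (PBond P j) := Finset.univ.filter fun b : PBond P j => b.dir = i0 ∧ (b.src i0).val < t with hS
    set M : Finset (PBond P j) := Finset.univ.filter fun b : PBond P j => b.dir = i0 ∧ (b.src i0).val = t with hM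
    have hmemS : ∀ {b : PBond P j}, b ∈ S ↔ b.dir = i0 ∧ (b.src i0).val < t := by intro b; simp [hS]
    have hmemM : ∀ {b : PBond P j}, b ∈ M ↔ b.dir = i0 ∧ (b.src i0).val = t := by intro b; simp [hM]
    have hunion : (Finset.univ.filter fun b : PBond P j => b.dir = i0 ∧ (b.src i0).val < t + 1) = S ∪ M := by
      ext b
      simp only [Finset.mem_union, hmemS, hmemM, Finset.mem_filter, Finset.mem_univ, true_and]
      constructor
      · rintro ⟨hd, hv⟩
        rcases Nat.lt_succ_iff_lt_or_eq.1 hv with h | h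
        · exact Or.inl ⟨hd, h⟩
        · exact Or.inr ⟨hd, h⟩
      · rintro (⟨hd, h⟩ | ⟨hd, h⟩)
        · exact ⟨hd, Nat.lt_succ_of_lt h⟩
        · exact ⟨hd, h ▸ Nat.lt_succ_self _⟩
    have hdisj : Disjoint S M := by
      rw [Finset.disjoint_left]
      intro b hbS hbM
      have h1 := (hmemS.1 hbS).2
      have h2 := (hmemM.1 hbM).2
      omega
    -- heights of targets in the layer: `t + 1`
    have htgt_val : ∀ b ∈ M, (b.tgt i0).val = t + 1 := by
      intro b hb
      obtain ⟨hd, hv⟩ := hmemM.1 hb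
      have := val_shift_dir P j b.src i0 (by omega)
      rw [PBond.tgt, hd]
      rw [hv] at this
      exact this
    have hsrc : ∀ b ∈ M, ∀ b' ∈ M, b'.tgt ≠ b.src := by
      intro b hb b' hb' heq
      have h1 := htgt_val b' hb'
      have h2 := (hmemM.1 hb).2
      rw [heq] at h1
      omega
    have hinj : Set.InjOn PBond.tgt (M : Set (PBond P j)) := by
      intro b hb b' hb' heq
      have hbd := (hmemM.1 (Finset.mem_coe.1 hb)).1
      have hb'd := (hmemM.1 (Finset.mem_coe.1 hb')).1
      have hs : b.src = b'.src := by
        funext κ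
        have hκ := congrFun heq κ
        simp only [PBond.tgt, hbd, hb'd] at hκ
        by_cases h : κ = i0
        · subst h
          have e1 : (b.src.shift i0) i0 = b.src i0 + 1 := by simp [Site.shift]
          have e2 : (b'.src.shift i0) i0 = b'.src i0 + 1 := by simp [Site.shift]
          rw [e1, e2] at hκ
          exact add_right_cancel hκ
        · rwa [shift_apply_ne P j _ _ _ h, shift_apply_ne P j _ _ _ h] at hκ
      cases b; cases b'
      simp only at hs hbd hb'd
      subst hs; subst hbd; subst hb'd; rfl
    have havoid : ∀ b ∈ M, ∀ b' ∈ S, b.tgt ≠ b'.src ∧ b.tgt ≠ b'.tgt := by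
      intro b hb b' hb'
      have h1 := htgt_val b hb
      obtain ⟨hd', hv'⟩ := hmemS.1 hb'
      have h2 : (b'.tgt i0).val = (b'.src i0).val + 1 := by
        rw [PBond.tgt, hd']; exact val_shift_dir P j b'.src i0 (by omega)
      constructor
      · intro heq; rw [heq] at h1; omega
      · intro heq; rw [heq] at h1; omega
    rw [hunion, Finset.card_union_of_disjoint hdisj]
    exact pow_mul_integral_eq_of_layer S M hdisj hsrc hinj havoid hB hF hFi hIH

/-- **COUNT: `n·|below (n−1)| = (n−1)·|T₁^{(j)}|`** — the non-wrapping direction-0 bonds are all sites but those of height `n−1`, and the fibres of `x ↦ x₀` are equicardinal (translation).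
So `|below (n−1)| = (1 − 1∕n)·|T₁^{(j)}|`. [folklore] -/
theorem card_below_top :
    (P.sitesPerDir j : ℝ) * ((Finset.univ.filter fun b : PBond P j => b.dir = ⟨0, P.hd⟩ ∧ (b.src ⟨0, P.hd⟩).val < P.sitesPerDir j - 1).card : ℝ) =
      ((P.sitesPerDir j : ℝ) - 1) * (Fintype.card (Site P j) : ℝ) := by
  classical
  set i0 : Fin P.d := ⟨0, P.hd⟩ with hi0
  set n : ℕ := P.sitesPerDir j with hn
  have hnpos : 0 < n := Nat.pos_of_ne_zero (P.sitesPerDir_ne_zero j)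
  -- fibres of the height map
  let fib : ZMod n → Finset (Site P j) := fun c => Finset.univ.filter fun x : Site P j => x i0 = c
  have hfib_eq : ∀ c : ZMod n, (fib c).card = (fib 0).card := by
    intro c
    refine Finset.card_bij' (fun x _ => Function.update x i0 (x i0 - c)) (fun x _ => Function.update x i0 (x i0 + c)) ?_ ?_ ?_ ?_
    · intro x hx
      have hx0 : x i0 = c := (Finset.mem_filter.1 hx).2
      exact Finset.mem_filter.2 ⟨Finset.mem_univ _, by rw [Function.update_self, hx0, sub_self]⟩
    · intro x hx
      have hx0 : x i0 = 0 := (Finset.mem_filter.1 hx).2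
      exact Finset.mem_filter.2 ⟨Finset.mem_univ _, by rw [Function.update_self, hx0, zero_add]⟩
    · intro x hx
      funext κ
      by_cases h : κ = i0
      · subst h; simp
      · simp [h]
    · intro x hx
      funext κ
      by_cases h : κ = i0
      · subst h; simp
      · simp [h]
  have hsum : Fintype.card (Site P j) = ∑ c : ZMod n, (fib c).card := by
    rw [← Finset.card_univ]
    exact Finset.card_eq_sum_card_fiberwise (f := fun x : Site P j => x i0) (fun x _ => Finset.mem_univ _)
  have hT : Fintype.card (Site P j) = n * (fib 0).card := by
    rw [hsum, Finset.sum_congr rfl (fun c _ => hfib_eq c), Finset.sum_const, Finset.card_univ, ZMod.card, smul_eq_mul]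
  -- the bonds below the top = sites not in the top fibre, via `x ↦ ⟨x, e₀⟩`
  have hval_top : ∀ x : Site P j, (x i0).val < n - 1 ↔ x i0 ≠ (((n - 1 : ℕ)) : ZMod n) := by
    intro x
    constructor
    · intro h heq
      rw [heq, ZMod.val_cast_of_lt (by omega)] at h
      exact lt_irrefl _ h
    · intro hne
      have hlt : (x i0).val < n := ZMod.val_lt _
      rcases Nat.lt_or_ge ((x i0).val) (n - 1) with h | h
      · exact h
      · exfalso; apply hne
        have hv : (x i0).val = n - 1 := by omega
        rw [← ZMod.natCast_zmod_val (x i0), hv]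
  have hcard_bonds : (Finset.univ.filter fun b : PBond P j => b.dir = i0 ∧ (b.src i0).val < n - 1).card =
      (Finset.univ.filter fun x : Site P j => x i0 ≠ (((n - 1 : ℕ)) : ZMod n)).card := by
    refine Finset.card_bij' (fun b _ => b.src) (fun x _ => (⟨x, i0⟩ : PBond P j)) ?_ ?_ ?_ ?_
    · intro b hb
      obtain ⟨-, hv⟩ := (Finset.mem_filter.1 hb).2
      exact Finset.mem_filter.2 ⟨Finset.mem_univ _, (hval_top _).1 hv⟩
    · intro x hx
      exact Finset.mem_filter.2 ⟨Finset.mem_univ _, rfl, (hval_top x).2 (Finset.mem_filter.1 hx).2⟩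
    · intro b hb
      obtain ⟨hd, -⟩ := (Finset.mem_filter.1 hb).2
      cases b; simp only at hd; subst hd; rfl
    · intro x hx; rfl
  have hcompl : (Finset.univ.filter fun x : Site P j => x i0 ≠ (((n - 1 : ℕ)) : ZMod n)).card + (fib (((n - 1 : ℕ)) : ZMod n)).card = Fintype.card (Site P j) := by
    rw [← Finset.card_univ, add_comm]
    exact Finset.card_filter_add_card_filter_not (fun x : Site P j => x i0 = (((n - 1 : ℕ)) : ZMod n))
  rw [hcard_bonds]
  have hm : (fib (((n - 1 : ℕ)) : ZMod n)).card = (fib 0).card := hfib_eq _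
  -- real arithmetic: n·(T − m) = (n−1)·T with T = n·m
  have hTR : (Fintype.card (Site P j) : ℝ) = (n : ℝ) * ((fib 0).card : ℝ) := by exact_mod_cast hT
  have hcomplR : ((Finset.univ.filter fun x : Site P j => x i0 ≠ (((n - 1 : ℕ)) : ZMod n)).card : ℝ) =
      (Fintype.card (Site P j) : ℝ) - ((fib 0).card : ℝ) := by
    have := congrArg (fun k : ℕ => (k : ℝ)) hcompl
    push_cast at this
    rw [hm] at this
    linarith
  rw [hcomplR, hTR]
  ring

end Layers

/-! ## §2. The sharp gauge-fixed lower bound on `Z` for `G = SU(N)` -/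

section LowerBound

open B16ZLower T4StabilityFloorUnitary

variable (N : ℕ) [NeZero N]

/-- **★★★ THE AXIAL-LAYER GAUSSIAN LOWER BOUND, `G = SU(N)`.**  For every `P : Params` and `β ≥ 1`, with `n = P.sitesPerDir 0` and `C_N = N²·log(16π+1) + log((2N+1)∕(4π))`:
`log Z_P(β) ≥ −((d − 1) + 1∕n)·|T₁^{(0)}|·((N²−1)∕2·log β + C_N) − 8d²·|T₁^{(0)}|` — all `|T|(1−1∕n)` non-wrapping direction-0 bonds gauged away (§4), the remaining `((d−1)+1∕n)|T|` bonds in the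
ball of radius `β^{−1∕2}` where the action per plaquette is `≤ 8∕β`. [folklore] -/
theorem log_partitionFn_ge_axialLayers_specialUnitary (P : Params) {β : ℝ} (hβ : 1 ≤ β) :
    -(((P.d : ℝ) - 1 + (P.sitesPerDir 0 : ℝ)⁻¹) * (Fintype.card (Site P 0) : ℝ)) *
        ((((N * N : ℕ) : ℝ) - 1) / 2 * Real.log β + (((N * N : ℕ) : ℝ) * Real.log (16 * Real.pi + 1) + Real.log ((2 * N + 1) / (4 * Real.pi))))
        - 8 * (P.d : ℝ) ^ 2 * (Fintype.card (Site P 0) : ℝ) ≤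
      Real.log (partitionFn (G := Matrix.specialUnitaryGroup (Fin N) ℂ) P β) := by
  classical
  set G := Matrix.specialUnitaryGroup (Fin N) ℂ
  have hβ0 : 0 < β := lt_of_lt_of_le one_pos hβ
  set τ : ℝ := (Real.sqrt β)⁻¹ with hτdef
  have hsq : 0 < Real.sqrt β := Real.sqrt_pos.2 hβ0
  have hτ : 0 < τ := inv_pos.2 hsq
  have hτ1 : τ ≤ 1 := by rw [hτdef]; exact inv_le_one_of_one_le₀ (Real.one_le_sqrt.2 hβ)
  have hτsq : τ ^ 2 = β⁻¹ := by rw [hτdef, inv_pow, Real.sq_sqrt hβ0.le]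
  have hlogτ : Real.log τ = -(1 / 2) * Real.log β := by rw [hτdef, Real.log_inv, Real.log_sqrt hβ0.le]; ring
  set B : Set G := suOpBall N τ with hBdef
  have hB : MeasurableSet B := measurableSet_suOpBall τ
  set c : ℝ := (HaarData.haar : Measure G).real B with hc
  have hcpos : 0 < c := haarReal_suOpBall_pos (N := N) hτ
  -- the layered identity at the Boltzmann weight, height `n − 1`
  set n : ℕ := P.sitesPerDir 0 with hn
  have hnpos : 0 < n := Nat.pos_of_ne_zero (P.sitesPerDir_ne_zero 0)
  have hid := pow_mul_integral_eq_prod_indicator_below P 0 hB (gaugeInvariant_boltzmann P β)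
    (integrable_boltzmann RegularGaugeGroup.measurable_reTr P hβ0.le) (n - 1) (by omega)
  set Mtop : Finset (PBond P 0) := Finset.univ.filter fun b : PBond P 0 => b.dir = ⟨0, P.hd⟩ ∧ (b.src ⟨0, P.hd⟩).val < n - 1 with hMtop
  -- lower bound of the constrained integral by the full box
  set a : ℝ := Real.exp (-(β * (8 * τ ^ 2 * Fintype.card (Plaq P 0)))) with ha
  have hlow_int : ∫ U, a * ∏ b, B.indicator (fun _ => (1 : ℝ)) (U b) ∂(fieldMeasure P 0 G) = a * c ^ Fintype.card (PBond P 0) := by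
    rw [integral_const_mul]
    congr 1
    show (∫ U : PBond P 0 → G, ∏ b, B.indicator (fun _ => (1 : ℝ)) (U b) ∂(Measure.pi fun _ : PBond P 0 => (HaarData.haar : Measure G))) = _
    rw [integral_fintype_prod_eq_prod (fun (_ : PBond P 0) (w : G) => B.indicator (fun _ => (1 : ℝ)) w)]
    have hone : (∫ w : G, B.indicator (fun _ => (1 : ℝ)) w ∂(HaarData.haar : Measure G)) = c := integral_indicator_one hB
    simp only [hone]
    rw [Finset.prod_const, Finset.card_univ]
  have hprod_meas : Measurable fun U : GaugeField P 0 G => ∏ b ∈ Mtop, B.indicator (fun _ => (1 : ℝ)) (U b) :=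
    Finset.measurable_prod _ fun b _ => (measurable_const.indicator hB).comp (measurable_pi_apply b)
  have hprod_bdd : ∀ U : GaugeField P 0 G, ‖∏ b ∈ Mtop, B.indicator (fun _ => (1 : ℝ)) (U b)‖ ≤ 1 := by
    intro U
    rw [Real.norm_eq_abs, Finset.abs_prod]
    refine Finset.prod_le_one (fun b _ => abs_nonneg _) fun b _ => ?_
    rw [abs_of_nonneg (Set.indicator_nonneg (fun _ _ => zero_le_one) _)]
    exact Set.indicator_le_self' (fun _ _ => zero_le_one) _
  have hup_int : Integrable (fun U : GaugeField P 0 G => boltzmann P β U * ∏ b ∈ Mtop, B.indicator (fun _ => (1 : ℝ)) (U b)) (fieldMeasure P 0 G) := by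
    have h := (integrable_boltzmann RegularGaugeGroup.measurable_reTr P hβ0.le (G := G)).bdd_mul hprod_meas.aestronglyMeasurable
      (Filter.Eventually.of_forall hprod_bdd)
    refine h.congr (Filter.Eventually.of_forall fun U => ?_)
    ring
  have hbox : a * c ^ Fintype.card (PBond P 0) ≤ c ^ Mtop.card * partitionFn (G := G) P β := by
    rw [show partitionFn (G := G) P β = ∫ U, boltzmann P β U ∂(fieldMeasure P 0 G) from rfl, hid, ← hlow_int]
    refine integral_mono_of_nonneg (Filter.Eventually.of_forall fun U => ?_) hup_int (Filter.Eventually.of_forall fun U => ?_)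
    · exact mul_nonneg (Real.exp_nonneg _) (Finset.prod_nonneg fun b _ => Set.indicator_nonneg (fun _ _ => zero_le_one) _)
    · show a * ∏ b, B.indicator (fun _ => (1 : ℝ)) (U b) ≤ boltzmann P β U * ∏ b ∈ Mtop, B.indicator (fun _ => (1 : ℝ)) (U b)
      by_cases hall : ∀ b, U b ∈ B
      · have h1 : ∏ b, B.indicator (fun _ => (1 : ℝ)) (U b) = 1 := Finset.prod_eq_one fun b _ => by simp [Set.indicator_of_mem (hall b)]
        have h2 : ∏ b ∈ Mtop, B.indicator (fun _ => (1 : ℝ)) (U b) = 1 := Finset.prod_eq_one fun b _ => by simp [Set.indicator_of_mem (hall b)]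
        rw [h1, h2, mul_one, mul_one, ha, boltzmann]
        refine Real.exp_le_exp.2 ?_
        have hA := wilsonAction4_le_of_bondBall N (P := P) (j := 0) (τ := τ) (U := U) hall
        nlinarith
      · simp only [not_forall] at hall
        obtain ⟨b₀, hb₀⟩ := hall
        have h1 : ∏ b, B.indicator (fun _ => (1 : ℝ)) (U b) = 0 :=
          Finset.prod_eq_zero (Finset.mem_univ b₀) (Set.indicator_of_notMem hb₀ _)
        rw [h1, mul_zero]
        exact mul_nonneg (boltzmann_pos P β U).le (Finset.prod_nonneg fun b _ => Set.indicator_nonneg (fun _ _ => zero_le_one) _)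
  -- counts
  have hZ : 0 < partitionFn (G := G) P β := partitionFn_pos' P hβ0.le
  set T : ℕ := Fintype.card (Site P 0) with hT
  have hbonds : Fintype.card (PBond P 0) = T * P.d := T4PlaqDisjointFamilies.card_pbond P 0
  have hplaq : Fintype.card (Plaq P 0) ≤ T * (P.d * P.d) := card_plaq_le P 0
  have hMle : Mtop.card ≤ Fintype.card (PBond P 0) := by rw [← Finset.card_univ]; exact Finset.card_le_univ _
  have hMcount : (n : ℝ) * (Mtop.card : ℝ) = ((n : ℝ) - 1) * (T : ℝ) := card_below_top P 0
  have hsplit : c ^ Fintype.card (PBond P 0) = c ^ Mtop.card * c ^ (Fintype.card (PBond P 0) - Mtop.card) := by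
    rw [← pow_add, Nat.add_sub_cancel' hMle]
  have hZge : a * c ^ (Fintype.card (PBond P 0) - Mtop.card) ≤ partitionFn (G := G) P β := by
    have h1 : c ^ Mtop.card * (a * c ^ (Fintype.card (PBond P 0) - Mtop.card)) ≤ c ^ Mtop.card * partitionFn (G := G) P β := by
      calc c ^ Mtop.card * (a * c ^ (Fintype.card (PBond P 0) - Mtop.card)) = a * c ^ Fintype.card (PBond P 0) := by rw [hsplit]; ring
        _ ≤ c ^ Mtop.card * partitionFn (G := G) P β := hbox
    exact le_of_mul_le_mul_left h1 (pow_pos hcpos _)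
  have hlogZ := Real.log_le_log (mul_pos (Real.exp_pos _) (pow_pos hcpos _)) hZge
  rw [Real.log_mul (Real.exp_pos _).ne' (pow_pos hcpos _).ne', Real.log_exp, Real.log_pow] at hlogZ
  refine le_trans ?_ hlogZ
  have hexp : -(β * (8 * τ ^ 2 * Fintype.card (Plaq P 0))) = -(8 * (Fintype.card (Plaq P 0) : ℝ)) := by rw [hτsq]; field_simp
  have hplaqR : (Fintype.card (Plaq P 0) : ℝ) ≤ (T : ℝ) * ((P.d : ℝ) * (P.d : ℝ)) := by exact_mod_cast hplaq
  have hlogc := log_haarReal_suOpBall_ge N hτ hτ1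
  rw [hlogτ] at hlogc
  -- the free-bond count `(d − 1 + 1/n)·T`
  have hnR : (0 : ℝ) < (n : ℝ) := by exact_mod_cast hnpos
  have hfree : ((Fintype.card (PBond P 0) - Mtop.card : ℕ) : ℝ) = ((P.d : ℝ) - 1 + (n : ℝ)⁻¹) * (T : ℝ) := by
    rw [Nat.cast_sub hMle, hbonds, Nat.cast_mul]
    have hM : (Mtop.card : ℝ) = ((n : ℝ) - 1) * (T : ℝ) / (n : ℝ) := by
      field_simp; linarith [hMcount]
    rw [hM]; field_simp; ring
  have hfree_nonneg : 0 ≤ ((P.d : ℝ) - 1 + (n : ℝ)⁻¹) * (T : ℝ) := by rw [← hfree]; exact Nat.cast_nonneg _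
  rw [hexp, hfree]
  have hkey : ((P.d : ℝ) - 1 + (n : ℝ)⁻¹) * (T : ℝ) *
      ((((N * N : ℕ) : ℝ) - 1) * (-(1 / 2) * Real.log β) - (((N * N : ℕ) : ℝ) * Real.log (16 * Real.pi + 1) + Real.log ((2 * N + 1) / (4 * Real.pi)))) ≤
      ((P.d : ℝ) - 1 + (n : ℝ)⁻¹) * (T : ℝ) * Real.log c := mul_le_mul_of_nonneg_left hlogc hfree_nonneg
  nlinarith [hkey, hplaqR]

/-- **`d = 4`**: `log Z_P(β) ≥ −(3 + 1∕n)·|T₁^{(0)}|·((N²−1)∕2·log β + C_N) − 128·|T₁^{(0)}|`, `n = P.sitesPerDir 0`, `β ≥ 1`. [folklore] -/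
theorem log_partitionFn_ge_axialLayers_specialUnitary_d4 (P : Params) (hd : P.d = 4) {β : ℝ} (hβ : 1 ≤ β) :
    -((3 + (P.sitesPerDir 0 : ℝ)⁻¹) * (Fintype.card (Site P 0) : ℝ)) *
        ((((N * N : ℕ) : ℝ) - 1) / 2 * Real.log β + (((N * N : ℕ) : ℝ) * Real.log (16 * Real.pi + 1) + Real.log ((2 * N + 1) / (4 * Real.pi))))
        - 128 * (Fintype.card (Site P 0) : ℝ) ≤
      Real.log (partitionFn (G := Matrix.specialUnitaryGroup (Fin N) ℂ) P β) := by
  have h := log_partitionFn_ge_axialLayers_specialUnitary N P hβ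
  have hd4 : (P.d : ℝ) = 4 := by exact_mod_cast hd
  rw [hd4] at h
  refine le_trans (le_of_eq ?_) h
  ring

end LowerBound

end Summit.QuantumFields.YangMills.BalabanUVNodes.N13GaugeFixingAxialLayers

end
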